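import Mathlib
import Summits.Ventures.PercRepro.TriangleCapCapTGen

/-!
# PercRepro — THE CAP ON THE CELLS `(k, a, a − 2)` AND `(k, a, a − 1)`, ASSEMBLED: a `K₄⁻`-free graph with
`a (k − a) − r` edges (`r ∈ {a − 2, a − 1}`, `a ≥ 5`, `k ≥ a + 2r + 2`) and a vertex of degree `k − a` is
`a`-bipartite or `Σ_v d(v)² + r (k − 1 − r) + 2 (k − 2a − 1) ≤ m k` (p3, gen 47; part 200g)

The skeleton of part 196a's `below_cap_gen` (the count, `E = 0` by `below_cap_noedge`), then `M ≤ 1`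
(`capT_matching`); `M = 0` is `D ⊆ K(N(x)ᶜ, N(x))`; `M = 1` is the one-triangle structure with the `R`-sum
(`capT_R_sum`, deficit `δ = r + 2 − a ≤ 1`), the `N`-sum (`cap_sq_bound_gen`, `2 Σ fg ≤ (a − 1) · 2`) and the
arithmetic `capT_sq_arith`. Axioms: standard.
-/

namespace PercRepro

namespace TriangleCap

namespace C047

open Finset

variable {V : Type*} [Fintype V] [DecidableEq V]

/-- **THE CAP ON `(k, a, r)` FOR `r ∈ {a − 2, a − 1}`, `a ≥ 5`, `k ≥ a + 2r + 2`:** a `K₄⁻`-free graph with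
`a (k − a) − r` edges and a vertex `x` of degree `k − a` is a spanning subgraph of some `K(A, Aᶜ)` with `|A| = a`, or
`Σ_v d(v)² + r (k − 1 − r) + 2 (k − 2a − 1) ≤ m k`. -/
theorem cap_T_gen (D : SimpleGraph V) [DecidableRel D.Adj] (hK : K4mFree D) (a r : ℕ) (ha5 : 5 ≤ a)
    (hra : r + 1 ≤ a) (har : a ≤ r + 2) (hk : 2 * a + r ≤ Fintype.card V)
    (hm : D.edgeFinset.card + r = a * (Fintype.card V - a)) (hK1 : 2 * r + 2 + a ≤ Fintype.card V) (x : V)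
    (hx : deg D x + a = Fintype.card V) :
    (∃ A : Finset V, A.card = a ∧ BipSub D A) ∨
      ∑ v, deg D v * deg D v + r * (Fintype.card V - 1 - r) + 2 * (Fintype.card V - 2 * a - 1) ≤
        D.edgeFinset.card * Fintype.card V := by
  obtain ⟨N, hN⟩ : ∃ N : Finset V, N = univ.filter (fun w => D.Adj x w) := ⟨_, rfl⟩
  have hmemN : ∀ w, w ∈ N ↔ D.Adj x w := fun w => by rw [hN, mem_filter]; simp only [mem_univ, true_and]
  have hxN : x ∉ N := fun h => D.irrefl ((hmemN x).mp h)
  have hdx : deg D x = N.card := by rw [hN]; rfl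
  obtain ⟨K, hKdef⟩ : ∃ K, N.card = K := ⟨_, rfl⟩
  have hcardV : Fintype.card V = K + a := by omega
  obtain ⟨m, hmdef⟩ : ∃ m, D.edgeFinset.card = m := ⟨_, rfl⟩
  -- the max-degree cap: every degree is `≤ k − a`
  have hcap : ∀ v, deg D v + a ≤ Fintype.card V := fun v =>
    deg_add_le_card_of_dense D hK a (by omega) (by omega)
      (cap_arith a (Fintype.card V) D.edgeFinset.card r (by omega) hk
        (below_cap_arith a (Fintype.card V) D.edgeFinset.card r (by omega) hm)) v
  rw [hmdef, hcardV, Nat.add_sub_cancel] at hm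
  -- the non-neighbours `R`, `|R| = a − 1`
  obtain ⟨R, hR⟩ : ∃ R : Finset V, R = (insert x N)ᶜ := ⟨_, rfl⟩
  have hRcard : R.card + 1 = a := by
    rw [hR, card_compl, card_insert_of_notMem hxN]
    omega
  have hmemR : ∀ w, w ∈ R ↔ w ≠ x ∧ ¬ D.Adj x w := by
    intro w
    rw [hR, mem_compl, mem_insert, hmemN]
    tauto
  -- the matching inside `N`
  obtain ⟨M, hM⟩ : ∃ M, adjPairs D N = 2 * M := ⟨_, adjPairs_eq_two_mul D N⟩
  have hTf : ∑ y ∈ N, degIn D N y = 2 * M := by rw [← adjPairs_eq_sum_degIn, hM]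
  -- `P = Σ_{u ∈ R} degIn N u`, `E = adjPairs R`
  obtain ⟨P, hPdef⟩ : ∃ P, ∑ u ∈ R, degIn D N u = P := ⟨_, rfl⟩
  obtain ⟨E, hEdef⟩ : ∃ E, adjPairs D R = E := ⟨_, rfl⟩
  -- the degree sum over `{x} ∪ N ∪ R`
  have hsplit : ∀ F : V → ℕ, ∑ w, F w = F x + ∑ y ∈ N, F y + ∑ u ∈ R, F u := by
    intro F
    rw [← sum_add_sum_compl (insert x N), sum_insert hxN, ← hR]
  have hdegN : ∀ y ∈ N, deg D y = 1 + degIn D N y + degIn D R y := by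
    intro y hy
    have := deg_eq_of_mem_nbhd D x y ((hmemN y).mp hy)
    rw [← hN, ← hR] at this
    exact this
  have hsumN : ∑ y ∈ N, deg D y = K + 2 * M + P := by
    rw [sum_congr rfl hdegN, sum_add_distrib, sum_add_distrib, sum_const, smul_eq_mul, mul_one, hKdef, hTf,
      sum_degIn_comm D N R, hPdef]
  have hdegR : ∀ u ∈ R, deg D u = degIn D N u + degIn D R u := by
    intro u hu
    have := deg_eq_of_not_mem_nbhd D x u ((hmemR u).mp hu).2
    rw [← hN, ← hR] at this
    exact this
  have hsumR : ∑ u ∈ R, deg D u = P + E := by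
    rw [sum_congr rfl hdegR, sum_add_distrib, hPdef, ← adjPairs_eq_sum_degIn, hEdef]
  have hdegsum := sum_deg_eq D
  rw [hsplit, hsumN, hsumR, hdx, hKdef, hmdef] at hdegsum
  -- (1) every vertex of `R` has degree `≤ K`
  have h1 : P + E ≤ (a - 1) * K := by
    rw [← hsumR]
    calc ∑ u ∈ R, deg D u ≤ ∑ _u ∈ R, K := sum_le_sum (fun u _ => by have := hcap u; omega)
      _ = (a - 1) * K := by rw [sum_const, smul_eq_mul]; congr 1; omega
  -- (2) every vertex of `R` has at most `K − M` neighbours in `N`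
  have hPle : ∀ u ∈ R, degIn D N u + M ≤ K := by
    intro u hu
    have := two_mul_degIn_add_adjPairs_le D hK (x := x) ((hmemR u).mp hu).1
    rw [← hN, hM, hKdef] at this
    omega
  have h2 : P + (a - 1) * M ≤ (a - 1) * K := by
    have hs : ∑ u ∈ R, (degIn D N u + M) ≤ ∑ _u ∈ R, K := sum_le_sum hPle
    rw [sum_add_distrib, sum_const, sum_const, smul_eq_mul, smul_eq_mul, hPdef] at hs
    have e : R.card = a - 1 := by omega
    rw [e] at hs
    exact hs
  obtain ⟨a', rfl⟩ : ∃ a', a = a' + 4 := ⟨a - 4, by omega⟩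
  have e1 : a' + 4 - 1 = a' + 3 := by omega
  rw [e1] at h1 h2
  have hK1' : 2 * r + 2 ≤ K := by omega
  -- (3) `(a − 3) M ≤ 2r`
  have hM1 : (a' + 1) * M ≤ 2 * r := below_cap_count a' K M P E m r hdegsum hm h1 h2
  -- (4) no edge inside `R`
  have hE0 : E = 0 := by
    by_contra hE
    obtain ⟨u, hu, hu1⟩ : ∃ u ∈ R, 1 ≤ degIn D R u := by
      by_contra hcon
      push Not at hcon
      have h0 : ∑ u ∈ R, degIn D R u = 0 := sum_eq_zero (fun u hu => by have := hcon u hu; omega)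
      rw [← adjPairs_eq_sum_degIn, hEdef] at h0
      exact hE h0
    obtain ⟨v, hv, huv⟩ : ∃ v ∈ R, D.Adj u v := by
      unfold degIn at hu1
      obtain ⟨v, hv⟩ := card_pos.mp hu1
      rw [mem_filter] at hv
      exact ⟨v, hv.1, hv.2⟩
    have hne : u ≠ v := D.ne_of_adj huv
    have hPuv : degIn D N u + degIn D N v ≤ K + 1 := by
      have := degIn_add_degIn_le_of_adj_pair D hK N huv
      rw [hKdef] at this
      exact this
    have hvR' : v ∈ R.erase u := mem_erase.mpr ⟨hne.symm, hv⟩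
    have hsum1 := add_sum_erase R (fun w => degIn D N w) hu
    have hsum2 := add_sum_erase (R.erase u) (fun w => degIn D N w) hvR'
    have hcard2 : ((R.erase u).erase v).card = a' + 1 := by
      rw [card_erase_of_mem hvR', card_erase_of_mem hu]
      omega
    have hrest : ∑ w ∈ (R.erase u).erase v, degIn D N w + (a' + 1) * M ≤ (a' + 1) * K := by
      have hs : ∑ w ∈ (R.erase u).erase v, (degIn D N w + M) ≤ ∑ _w ∈ (R.erase u).erase v, K :=
        sum_le_sum (fun w hw => hPle w (mem_of_mem_erase (mem_of_mem_erase hw)))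
      rw [sum_add_distrib, sum_const, sum_const, smul_eq_mul, smul_eq_mul, hcard2] at hs
      exact hs
    obtain ⟨Pu, hPu⟩ : ∃ Pu, degIn D N u = Pu := ⟨_, rfl⟩
    obtain ⟨Pv, hPv⟩ : ∃ Pv, degIn D N v = Pv := ⟨_, rfl⟩
    obtain ⟨Pr, hPr⟩ : ∃ Pr, ∑ w ∈ (R.erase u).erase v, degIn D N w = Pr := ⟨_, rfl⟩
    rw [hPu, hPv] at hPuv
    rw [hPu, hPdef] at hsum1
    rw [hPv, hPr] at hsum2
    rw [hPr] at hrest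
    exact below_cap_noedge a' K M P E m r Pu Pv Pr hdegsum hm h1 hM1 hPuv hrest
      (by rw [← hsum1, ← hsum2]; ring) hK1' (fun h => by omega)
  -- (5) `M ≤ 1`
  have hM1' : M ≤ 1 := capT_matching (a' + 4) K M P m r (by omega)
    (by rw [hE0] at hdegsum; exact hdegsum) hm (by rw [e1]; exact h2) hra
  -- no edge inside `R`
  have hnoR : ∀ u ∈ R, degIn D R u = 0 := by
    intro u hu
    have hle : degIn D R u ≤ ∑ z ∈ R, degIn D R z := single_le_sum (fun _ _ => Nat.zero_le _) hu
    rw [← adjPairs_eq_sum_degIn, hEdef, hE0] at hle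
    exact Nat.le_zero.mp hle
  rcases Nat.eq_zero_or_pos M with hM0 | hMpos
  · -- `M = 0`: no edge inside `N`, none inside `R`: `D ⊆ K(Nᶜ, N)`
    left
    have hnoN : ∀ y ∈ N, ∀ y', D.Adj y y' → y' ∉ N := by
      intro y hy y' hyy' hy'
      have h0 : degIn D N y = 0 := by
        have hle : degIn D N y ≤ ∑ z ∈ N, degIn D N z := single_le_sum (fun _ _ => Nat.zero_le _) hy
        rw [hTf, hM0, mul_zero] at hle
        exact Nat.le_zero.mp hle
      unfold degIn at h0
      rw [card_eq_zero, filter_eq_empty_iff] at h0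
      exact h0 hy' hyy'
    have hnoR' : ∀ u ∈ R, ∀ u', D.Adj u u' → u' ∉ R := by
      intro u hu u' huu' hu'
      have h0 := hnoR u hu
      unfold degIn at h0
      rw [card_eq_zero, filter_eq_empty_iff] at h0
      exact h0 hu' huu'
    refine ⟨Nᶜ, ?_, ?_⟩
    · rw [card_compl, hKdef]
      omega
    · intro p q hpq
      rw [mem_compl, mem_compl, not_not]
      constructor
      · intro hpN
        by_contra hqN
        by_cases hpx : p = x
        · subst hpx
          exact hqN ((hmemN q).mpr hpq)
        by_cases hqx : q = x
        · subst hqx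
          exact hpN ((hmemN p).mpr (D.adj_symm hpq))
        have hpR : p ∈ R := (hmemR p).mpr ⟨hpx, fun h => hpN ((hmemN p).mpr h)⟩
        have hqR : q ∈ R := (hmemR q).mpr ⟨hqx, fun h => hqN ((hmemN q).mpr h)⟩
        exact hnoR' p hpR q hpq hqR
      · intro hqN hpN
        exact hnoN p hpN q hpq hqN
  · -- `M = 1`: the one-triangle structure
    right
    have hM1'' : M = 1 := by omega
    subst hM1''
    have hP : P + r + 1 + K = (a' + 4) * K := by omega
    obtain ⟨δ, hδ⟩ : ∃ δ, r + 2 = a' + 4 + δ := ⟨r + 2 - (a' + 4), by omega⟩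
    have hδ1 : δ ≤ 1 := by omega
    have hPle' : ∀ u ∈ R, degIn D N u + 1 ≤ K := hPle
    -- the `R`-sum
    have hsumR' : ∑ u ∈ R, degIn D N u + δ = R.card * (K - 1) := by
      rw [hPdef]
      have e : R.card = a' + 3 := by omega
      rw [e]
      obtain ⟨K', rfl⟩ : ∃ K', K = K' + 1 := ⟨K - 1, by omega⟩
      rw [Nat.add_sub_cancel]
      nlinarith [hP, hδ]
    have hSR := capT_R_sum D R N K δ (by omega) hPle' hsumR' hδ1
    have hdegRu : ∀ t ∈ R, deg D t = degIn D N t := fun t ht => by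
      rw [hdegR t ht, hnoR t ht, add_zero]
    have hSR' : ∑ u ∈ R, deg D u * deg D u + (2 * K - 3) * δ ≤ (a' + 4 - 1) * ((K - 1) * (K - 1)) := by
      rw [sum_congr rfl (fun t ht => by rw [hdegRu t ht])]
      have e : R.card = a' + 4 - 1 := by omega
      rw [← e]
      exact hSR
    -- the `N`-sum: `Σ_N d² ≤ K + 6 + (a + 1) P + 2 (a − 1)`
    have hfg : ∑ y ∈ N, degIn D N y * degIn D R y ≤ a' + 3 := by
      have := two_mul_sum_degIn_mul_degIn_le D hK x R (fun u hu => ((hmemR u).mp hu).1)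
      rw [← hN, hM] at this
      have e : R.card = a' + 3 := by omega
      rw [e] at this
      omega
    have hSN : ∑ y ∈ N, deg D y * deg D y ≤ K + 6 + (a' + 4 + 1) * P + 2 * (a' + 4 - 1) := by
      have h : ∀ y ∈ N, deg D y * deg D y ≤
          1 + 3 * degIn D N y + (a' + 4 + 1) * degIn D R y + 2 * (degIn D N y * degIn D R y) := by
        intro y hy
        rw [hdegN y hy]
        apply cap_sq_bound_gen
        · have h1 := degIn_nbhd_le_one D hK (x := x) (u := y) ((hmemN y).mp hy)
          rw [← hN] at h1
          exact h1
        · have := degIn_le_card D R y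
          omega
      calc ∑ y ∈ N, deg D y * deg D y
          ≤ ∑ y ∈ N, (1 + 3 * degIn D N y + (a' + 4 + 1) * degIn D R y + 2 * (degIn D N y * degIn D R y)) :=
            sum_le_sum h
        _ = N.card + 3 * ∑ y ∈ N, degIn D N y + (a' + 4 + 1) * ∑ y ∈ N, degIn D R y +
            2 * ∑ y ∈ N, degIn D N y * degIn D R y := by
          rw [sum_add_distrib, sum_add_distrib, sum_add_distrib, sum_const, smul_eq_mul, mul_one, mul_sum,
            mul_sum, mul_sum]
        _ ≤ K + 6 + (a' + 4 + 1) * P + 2 * (a' + 4 - 1) := by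
          rw [hKdef, hTf, sum_degIn_comm D N R, hPdef]
          have e : a' + 4 - 1 = a' + 3 := by omega
          rw [e]
          omega
    rw [hsplit (fun v => deg D v * deg D v), hdx, hKdef, hmdef, hcardV]
    exact capT_sq_arith (a' + 4) K P _ _ m r δ ha5 hδ hδ1 hK1' hm hP hSN hSR'

end C047

end TriangleCap

end PercRepro
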